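import Summits.AtomisticToContinuum.Crystallization.Theorems.PricedLinkCensusTruncatedCensusGapCruxForms
import Summits.AtomisticToContinuum.Crystallization.Theorems.PricedLinkCensusTruncatedCensusGapGapOfSeparatedPeriodicPricing

/-!
# `TruncatedCensusGap` (stmt-AtomisticToContinuum-14230): the SEPARATED PERIODIC FORM of the crux

Lead c3 of line `sharp-m-potential-compactness`, composition of the landed periodic form
(`truncatedCensusGap_iff_periodicPricing`, p127999) with the landed separated-periodic reduction
(`truncatedCensusGap_of_separatedPeriodicPricing`, p128838):

`truncatedCensusGap_iff_separatedPeriodicPricing` — **the crux is EXACTLY the periodic pricing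
demanded of UNIFORMLY `1/4`-SEPARATED periodic configurations**:
`TruncatedCensusGap ↔ ∃ κ > 0, ∀ Q : PeriodicConfiguration 3, (points of Q pairwise ≥ 1/4 apart) →
κ · motifCharged (1/100) Q ≤ #F · (e_χ(Q) − e_χ*)`.
This is the most compact form of the crux in the tree: a statement about the compact strata
(bounded local complexity) of Blanc–Lewin's periodic universe only — "finite-range periodic
crystallization with defect pricing for `V_χ`".  Stratified by motif size `#F = n` it is a family
of finite-dimensional inequalities with a UNIFORM price; the uniformity in `n` is the open content
(see the line card).  `[folklore]` bookkeeping; the content of the crux is untouched.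
-/

noncomputable section

namespace Summit.AtomisticToContinuum.Crystallization.Theorems.PricedLinkCensusTruncatedCensusGap

open Literature.MathematicalPhysics.StatisticalMechanics Literature.Geometry.DiscreteGeometry

/-- **`TruncatedCensusGap` is EQUIVALENT to the periodic pricing for uniformly `1/4`-separated
periodic configurations** (the crux ⇒ pricing of every periodic `Q` by the periodic form, in
particular of the separated ones; conversely p128838). [folklore] -/
theorem truncatedCensusGap_iff_separatedPeriodicPricing : Summit.AtomisticToContinuum.Crystallization.Theses.PricedLinkCensus.TruncatedCensusGap ↔ (∃ κ : ℝ, 0 < κ ∧ ∀ Q : PeriodicConfiguration 3, (∀ p ∈ Q.points, ∀ q ∈ Q.points, p ≠ q → 1 / 4 ≤ dist p q) → κ * (Summit.AtomisticToContinuum.Crystallization.Theorems.ChargedEnergyGapNegative.motifCharged (1 / 100) Q : ℝ) ≤ (Q.motif.card : ℝ) * (Q.energyPerParticle (fun r => min 1 (max 0 (4 - 2 * r)) * lennardJones r) - ⨅ Q' : PeriodicConfiguration 3, Q'.energyPerParticle (fun r => min 1 (max 0 (4 - 2 * r)) * lennardJones r))) :=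
  ⟨fun h => by
    obtain ⟨κ, hκ, hp⟩ := periodicPricing_of_truncatedCensusGap h
    exact ⟨κ, hκ, fun Q _ => hp Q⟩,
   truncatedCensusGap_of_separatedPeriodicPricing⟩

end Summit.AtomisticToContinuum.Crystallization.Theorems.PricedLinkCensusTruncatedCensusGap

end
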